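import Literature.Analysis.Distribution.TranslationQuasiInvariantClosedForm
import Mathlib.LinearAlgebra.Span.Defs
import HarnessLib

/-!
# Substitutions in the iterated line averages: linear maps permuting the directions, translations, spans

Topic `Analysis/Distribution`; namespace `Literature.Analysis.Distribution`. Bookkeeping identities for the
twisted line averages `A_d`, `A_L` of `TranslationQuasiInvariantClosedForm`, used to transport the
Gelfand–Kazhdan involution and the unipotent shears through the structure theorem without any Fubini argument:

* `lineAvg_comp_linear` — for a continuous linear `Φ` with `Φ v_d = v_{d'}`, `φ_{d'} ∘ Φ = φ_d`, `λ_{d'} = λ_d`: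
  `A_d (g ∘ Φ) = (A_{d'} g) ∘ Φ`; iterated: `lineAvgList_comp_linear` (`A_L (g ∘ Φ) = (A_{L'} g) ∘ Φ` for the
  correspondingly related lists);
* `lineAvg_comp_sub_const` — for `u` with `φ_d u = 0`: `A_d (x ↦ g (x - u)) = x ↦ (A_d g)(x - u)`; iterated:
  `lineAvgList_comp_sub_const`;
* `IsLineInvariant` functions along every direction of `L` are invariant under adding any element of the span of
  the `v_d`, `d ∈ L` (`apply_add_eq_of_mem_span`); in particular `A_L g (x + w) = A_L g (x)` for `w` in that span
  (`lineAvgList_add_eq_of_mem_span`);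
* `lineWeightList_perm` — the weight `W_L` only depends on `L` up to permutation.

Everything is proved; no named fact is introduced.

## References

* L. Hörmander, *The Analysis of Linear Partial Differential Operators I* (1983/2003), Thm. 3.1.4'
  [HormanderALPDO1].
-/

noncomputable section

open MeasureTheory Set Filter Topology Function
open scoped ContDiff ComplexConjugate

namespace Literature.Analysis.Distribution

variable {X : Type*} [NormedAddCommGroup X] [NormedSpace ℝ X]

/-! ### 1. Linear substitutions permuting the directions -/

/-- **Related directions under a linear map**: `Φ v_d = v_{d'}`, `φ_{d'} ∘ Φ = φ_d`, `λ_{d'} = λ_d`. [folklore] -/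
structure Direction.Related (Φ : X →L[ℝ] X) (d d' : Direction X) : Prop where
  /-- the vectors correspond -/
  map_v : Φ d.v = d'.v
  /-- the functionals correspond -/
  comp_φ : d'.φ.comp Φ = d.φ
  /-- the characters agree -/
  lam_eq : d'.lam = d.lam

/-- **`A_d (g ∘ Φ) = (A_{d'} g) ∘ Φ`** for related directions. [folklore] -/
theorem lineAvg_comp_linear {Φ : X →L[ℝ] X} {d d' : Direction X} (h : Direction.Related Φ d d') (g : X → ℂ) :
    lineAvg d (g ∘ Φ) = lineAvg d' g ∘ Φ := by
  funext x
  rw [Function.comp_apply, lineAvg_apply, lineAvg_apply, h.lam_eq]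
  refine integral_congr_ae (Eventually.of_forall fun s => ?_)
  have hφ : d'.φ (Φ x) = d.φ x := by rw [← ContinuousLinearMap.comp_apply, h.comp_φ]
  simp only [Function.comp_apply, map_add, map_sub, map_smul, h.map_v, hφ]

/-- **Iterated**: `A_L (g ∘ Φ) = (A_{L'} g) ∘ Φ` for entrywise related lists. [folklore] -/
theorem lineAvgList_comp_linear {Φ : X →L[ℝ] X} :
    ∀ {L L' : List (Direction X)} (_h : List.Forall₂ (Direction.Related Φ) L L') (g : X → ℂ),
      lineAvgList L (g ∘ Φ) = lineAvgList L' g ∘ Φ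
  | [], [], _, _ => rfl
  | d :: L, d' :: L', h, g => by
    obtain ⟨hd, hL⟩ := List.forall₂_cons.1 h
    simp only [lineAvgList]
    rw [lineAvg_comp_linear hd g]
    exact lineAvgList_comp_linear hL _

/-! ### 2. Translations invisible to the functionals -/

/-- **`A_d (g(· - u)) = (A_d g)(· - u)`** when `φ_d u = 0`. [folklore] -/
theorem lineAvg_comp_sub_const (d : Direction X) {u : X} (hu : d.φ u = 0) (g : X → ℂ) :
    lineAvg d (fun x => g (x - u)) = fun x => lineAvg d g (x - u) := by
  funext x
  rw [lineAvg_apply, lineAvg_apply]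
  refine integral_congr_ae (Eventually.of_forall fun s => ?_)
  simp only [map_sub, hu, sub_zero]
  congr 2
  abel

/-- **Iterated**: `A_L (g(· - u)) = (A_L g)(· - u)` when `φ_d u = 0` for all `d ∈ L`. [folklore] -/
theorem lineAvgList_comp_sub_const : ∀ (L : List (Direction X)) {u : X} (_hu : ∀ d ∈ L, d.φ u = 0) (g : X → ℂ),
    lineAvgList L (fun x => g (x - u)) = fun x => lineAvgList L g (x - u)
  | [], _, _, _ => rfl
  | d :: L, u, hu, g => by
    simp only [lineAvgList]
    rw [lineAvg_comp_sub_const d (hu d List.mem_cons_self) g]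
    exact lineAvgList_comp_sub_const L (fun e he => hu e (List.mem_cons_of_mem _ he)) _

/-! ### 3. Invariance under the span of the directions -/

/-- A function line-invariant along `d` is invariant under `x ↦ x + t v_d`. [folklore] -/
theorem IsLineInvariant.apply_add_smul {d : Direction X} {c : X → ℂ} (hc : IsLineInvariant d c) (x : X) (t : ℝ) :
    c (x + t • d.v) = c x := by
  have h1 := hc (x + t • d.v) (d.φ x)
  rw [proj_add_smul d.v d.φ d.hφv, line_decomp] at h1
  exact h1.symm

/-- **`A_e` preserves invariance along another biorthogonal direction `d`** (`φ_e v_d = 0`). [folklore] -/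
theorem IsLineInvariant.lineAvg {d e : Direction X} (hde : e.φ d.v = 0) {c : X → ℂ} (hc : IsLineInvariant d c) :
    IsLineInvariant d (lineAvg e c) := fun x s => by
  rw [lineAvg_apply, lineAvg_apply]
  refine integral_congr_ae (Eventually.of_forall fun r => ?_)
  have hφe : e.φ (s • d.v + (x - (d.φ x) • d.v)) = e.φ x := by
    simp only [map_add, map_sub, map_smul, hde, smul_eq_mul, mul_zero, zero_add, sub_zero]
  rw [hφe]
  have h := hc.apply_add_smul (r • e.v + (x - (e.φ x) • e.v)) (s - d.φ x)
  simp only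
  rw [← h]
  congr 2
  rw [sub_smul]
  abel

/-- **`A_L g` is line-invariant along every direction of a biorthogonal `L`.** [folklore] -/
theorem isLineInvariant_lineAvgList : ∀ (L : List (Direction X)) (_hL : Biorthogonal L) (g : X → ℂ),
    ∀ d ∈ L, IsLineInvariant d (lineAvgList L g)
  | [], _, _ => fun d hd => absurd hd List.not_mem_nil
  | e :: L, hL, g => by
    obtain ⟨he, hL'⟩ := biorthogonal_cons.1 hL
    intro d hd
    simp only [lineAvgList]
    rcases List.mem_cons.1 hd with rfl | hd
    · -- invariance along the head survives the later averages
      have key : ∀ (M : List (Direction X)) (_hM : ∀ e' ∈ M, e'.φ d.v = 0) (c : X → ℂ), IsLineInvariant d c →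
          IsLineInvariant d (lineAvgList M c) := by
        intro M
        induction M with
        | nil => exact fun _ c hc => hc
        | cons e' M ih =>
          intro hM c hc
          simp only [lineAvgList]
          exact ih (fun e'' he'' => hM e'' (List.mem_cons_of_mem _ he'')) _ (hc.lineAvg (hM e' List.mem_cons_self))
      exact key L (fun e' he' => (he e' he').2) _ (isLineInvariant_lineAvg d g)
    · exact isLineInvariant_lineAvgList L hL' _ d hd

/-- **A function line-invariant along every direction of `L` is invariant under the span of the `v_d`.**
[folklore] -/
theorem apply_add_eq_of_mem_span {L : List (Direction X)} {c : X → ℂ} (hc : ∀ d ∈ L, IsLineInvariant d c)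
    {w : X} (hw : w ∈ Submodule.span ℝ (Set.range fun d : {d // d ∈ L} => d.1.v)) (x : X) : c (x + w) = c x := by
  suffices h : ∀ (x : X) (t : ℝ), c (x + t • w) = c x by simpa using h x 1
  induction hw using Submodule.span_induction with
  | mem u hu =>
    obtain ⟨⟨d, hd⟩, rfl⟩ := hu
    exact fun x t => (hc d hd).apply_add_smul x t
  | zero => intro x t; rw [smul_zero, add_zero]
  | add u u' _ _ ihu ihu' => intro x t; rw [smul_add, ← add_assoc, ihu' (x + t • u) t, ihu x t]
  | smul t' u _ ihu => intro x t; rw [smul_smul]; exact ihu x (t * t')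

/-- **`A_L g` is invariant under the span of the directions of `L`.** [folklore] -/
theorem lineAvgList_add_eq_of_mem_span (L : List (Direction X)) (hL : Biorthogonal L) (g : X → ℂ) {w : X}
    (hw : w ∈ Submodule.span ℝ (Set.range fun d : {d // d ∈ L} => d.1.v)) (x : X) :
    lineAvgList L g (x + w) = lineAvgList L g x :=
  apply_add_eq_of_mem_span (isLineInvariant_lineAvgList L hL g) hw x

/-! ### 4. The weight is permutation-invariant -/

/-- `W_L(x)` as a list product. [folklore] -/
theorem lineWeightList_eq_prod (x : X) : ∀ L : List (Direction X), lineWeightList L x = (L.map fun d => lineWeight d x).prod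
  | [] => rfl
  | d :: L => by rw [lineWeightList, lineWeightList_eq_prod x L, List.map_cons, List.prod_cons]

/-- **`W_L = W_{L'}` for permutations `L ~ L'`.** [folklore] -/
theorem lineWeightList_perm {L L' : List (Direction X)} (h : L.Perm L') : lineWeightList L = lineWeightList L' := by
  funext x
  rw [lineWeightList_eq_prod, lineWeightList_eq_prod]
  exact (h.map _).prod_eq

/-- Biorthogonality is permutation-invariant. [folklore] -/
theorem Biorthogonal.perm {L L' : List (Direction X)} (hL : Biorthogonal L) (h : L.Perm L') : Biorthogonal L' :=
  h.pairwise hL fun hde => ⟨hde.2, hde.1⟩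

end Literature.Analysis.Distribution
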